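import Summits.QuantumFields.YangMills.Theorems.ColdStartUniversalityShenZhuZhuWilsonLoopVarianceSU2
import Summits.QuantumFields.YangMills.Theorems.ColdStartUniversalityShenZhuZhuTorusConcentrationSU2
import HarnessLib

/-!
# RECTANGULAR Wilson loops `W_{R×T}` in three-dimensional `SU(2)` lattice Yang–Mills at strong coupling: Gaussian concentration at the
# perimeter scale `√(R+T)` under every infinite-volume limit point and on every torus, and the variance bound `Var(W_{R×T}) ≤ (R+T)/(1 − 24|β|)`

Seat `ym-line-csu-p1` (g38), route `ColdStartUniversality` of `Summits/QuantumFields/YangMills`, helper file G8 — the explicit rectangle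
instances of G5–G7 (`…ShenZhuZhuWilsonLoopConcentrationSU2`, `…WilsonLoopVarianceSU2`, `…TorusConcentrationSU2`).

* `sum_dartMult_sq_rectWalk` (every `d`) — the links of a non-degenerate lattice rectangle `rectWalk x i j R T` (`i ≠ j`, `R, T ≥ 1`) are
  pairwise distinct, so `Σ_{e ∈ links} mult(e)² = |∂(R×T)| = 2(R+T)` (the oriented-edge lists of the four sides, adapted from the venture file
  `Summits/Ventures/YMGap/RobustBall/RectangleTrail.lean`, which is not built on the farm and cannot be imported).
* ★★★ `szz_rectangle_twoSided_su2` — for EVERY infinite-volume limit point `μ` of `SU(2)` lattice Yang–Mills on `ℤ³` at 't Hooft coupling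
  `|β| < 1/24`, every rectangle `R × T` (`R, T ≥ 1`) in a coordinate plane, based anywhere, and every `r ≥ 0`:
  `μ{|W_{R×T} − ⟨W_{R×T}⟩_μ| ≥ r} ≤ 2 exp(−(1 − 24|β|) r² / (2(R+T)))`, `W_{R×T} = ½ Re tr hol_{∂(R×T)}`.
* ★★ `szz_rectangle_variance_su2` — `Var_μ(W_{R×T}) ≤ (R + T)/(1 − 24|β|)` (Shen–Zhu–Zhu Cor. 1.5 / Rem. 4.6 shape, perimeter growth).
* ★★★ `torus_rectangle_twoSided_su2_uniform` — on every torus `(ℤ/L)³` on which the rectangle's links stay distinct, at tree coupling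
  `|β'| < 1/12`: `μ_{L,β'}{|W_{R×T} − ⟨W_{R×T}⟩| ≥ r} ≤ 2 exp(−(1 − 12|β'|) r²/(2(R+T)))`, the same in every volume.

THEOREMS ONLY, no definition, no sorry.  HONEST FRAMING: STRONG coupling, fixed lattice, `SU(2)`, `d = 3`; no area law, nothing at weak
coupling / in the continuum, nothing `K`-uniform along the route's scaling (`UniformColdStartMixing`, 24809, ASIDE, not restated); no crux, rung or
summit statement is proved; the Yang–Mills mass gap is NOT proved.

References: H. Shen, R. Zhu, X. Zhu, CMP 400 (2023) 805–851 = arXiv:2204.12737, Thm 1.4, Cor. 1.5, Rem. 4.6 [ShenZhuZhu2022].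
-/

set_option autoImplicit false

noncomputable section

namespace Summit.QuantumFields.YangMills.Theorems.ColdStartUniversality

open MeasureTheory ProbabilityTheory Finset Filter Set Function
open scoped BigOperators NNReal ENNReal Topology Matrix Matrix.Norms.Frobenius ContDiff
open SimpleGraph
open Literature.Probability.LatticeModels (Site zdGraph)
open Literature.Probability.Process Literature.MathematicalPhysics.QuantumFieldTheory
open Literature.MathematicalPhysics.QuantumLattice (fundamentalRep fundamentalLatticeRep continuous_fundamentalRep fundamentalRep_apply
  torusEdge torusLift infiniteVolumeLimitPoints LGConfig normalisedCharacter dartStep dartStep_symm dartStep_add_single wilsonLoopObs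
  loopExpectation lineWalk rectWalk length_rectWalk)
open Summit.Ventures.YMGap.RobustBall (dartMult sum_walkEdges_dartMult one_le_dartMult_of_mem)

/-! ## §1. The links of a lattice rectangle are pairwise distinct -/

/-- **`Σ_{e ∈ links} mult(e)² = 2(R+T)` for a non-degenerate lattice rectangle** (`i ≠ j`, `R, T ≥ 1`): the oriented edges under the darts of
`rectWalk x i j R T` are pairwise distinct (the four sides are straight walks with distinct edges, and different sides are told apart by
their direction or by the `i`- or `j`-coordinate of their base points), so every multiplicity is `1` and the sum is the perimeter.
Adapted from the venture file `Summits/Ventures/YMGap/RobustBall/RectangleTrail.lean` (not importable here). [folklore] -/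
theorem sum_dartMult_sq_rectWalk {d : ℕ} (x : Site d) {i j : Fin d} (hij : i ≠ j) {R T : ℕ} (hR : 1 ≤ R) (hT : 1 ≤ T) :
    ∑ e ∈ walkEdges (rectWalk x i j R T), (dartMult (rectWalk x i j R T) e : ℝ) ^ 2 = 2 * ((R : ℝ) + T) := by
  classical
  -- adapted from reserve-free venture source RobustBall/RectangleTrail.lean (`dartSteps_lineWalk`, `nodup_dartSteps_rectWalk`)
  -- (a) the oriented edges of a straight walk, in order
  have hline : ∀ (k : Fin d) (n : ℕ) (y : Site d),
      ((lineWalk k n y).darts.map fun a => (dartStep a).1) =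
        (List.range n).map fun m : ℕ => (y + Pi.single k (m : ℤ), k) := by
    intro k n
    induction n with
    | zero => intro y; simp [lineWalk]
    | succ n ih =>
      intro y
      rw [lineWalk, Walk.darts_cons, Walk.darts_copy, List.map_cons, dartStep_add_single, ih, List.range_succ_eq_map,
        List.map_cons, List.map_map]
      simp only [Nat.cast_zero, Pi.single_zero, add_zero]
      congr 1
      refine List.map_congr_left fun m _ => ?_
      simp only [comp_apply, Nat.succ_eq_add_one, Nat.cast_add, Nat.cast_one, Pi.single_add]
      abel
  have hmem : ∀ (k : Fin d) (n : ℕ) (y : Site d) (e : Literature.MathematicalPhysics.QuantumLattice.ZdEdge d),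
      e ∈ ((lineWalk k n y).darts.map fun a => (dartStep a).1) → ∃ m : ℕ, m < n ∧ e = (y + Pi.single k (m : ℤ), k) := by
    intro k n y e he
    rw [hline] at he
    obtain ⟨m, hm, hme⟩ := List.mem_map.1 he
    exact ⟨m, List.mem_range.1 hm, hme.symm⟩
  have hnodup_line : ∀ (k : Fin d) (n : ℕ) (y : Site d), ((lineWalk k n y).darts.map fun a => (dartStep a).1).Nodup := by
    intro k n y
    rw [hline]
    refine List.Nodup.map (fun m m' h => ?_) List.nodup_range
    have h1 := congrArg (fun e : Literature.MathematicalPhysics.QuantumLattice.ZdEdge d => e.1 k) h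
    simp only [Pi.add_apply, Pi.single_eq_same, add_right_inj, Nat.cast_inj] at h1
    exact h1
  have hrev : ∀ {y y' : Site d} (w : (zdGraph d).Walk y y'),
      (w.reverse.darts.map fun a => (dartStep a).1) = (w.darts.map fun a => (dartStep a).1).reverse := by
    intro y y' w
    rw [Walk.darts_reverse, List.map_reverse, List.map_map]
    congr 1
    exact List.map_congr_left fun a _ => by simp [dartStep_symm]
  -- (b) the oriented edges of the rectangle are pairwise distinct
  have hnd : ((rectWalk x i j R T).darts.map fun a => (dartStep a).1).Nodup := by
    have hA : ∀ e ∈ ((lineWalk i R x).darts.map fun a => (dartStep a).1), ∃ k : ℕ, k < R ∧ e = (x + Pi.single i (k : ℤ), i) :=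
      fun e he => hmem i R x e he
    have hB : ∀ e ∈ (((lineWalk j T (x + Pi.single i (R : ℤ))).copy rfl (add_right_comm _ _ _)).darts.map
        fun a => (dartStep a).1), ∃ k : ℕ, k < T ∧ e = (x + Pi.single i (R : ℤ) + Pi.single j (k : ℤ), j) := by
      intro e he
      rw [Walk.darts_copy] at he
      exact hmem j T _ e he
    have hC : ∀ e ∈ ((lineWalk i R (x + Pi.single j (T : ℤ))).reverse.darts.map fun a => (dartStep a).1),
        ∃ k : ℕ, k < R ∧ e = (x + Pi.single j (T : ℤ) + Pi.single i (k : ℤ), i) := by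
      intro e he
      rw [hrev, List.mem_reverse] at he
      exact hmem i R _ e he
    have hD : ∀ e ∈ ((lineWalk j T x).reverse.darts.map fun a => (dartStep a).1),
        ∃ k : ℕ, k < T ∧ e = (x + Pi.single j (k : ℤ), j) := by
      intro e he
      rw [hrev, List.mem_reverse] at he
      exact hmem j T x e he
    have hAC : ∀ e : Literature.MathematicalPhysics.QuantumLattice.ZdEdge d, (∃ k : ℕ, k < R ∧ e = (x + Pi.single i (k : ℤ), i)) →
        (∃ k : ℕ, k < R ∧ e = (x + Pi.single j (T : ℤ) + Pi.single i (k : ℤ), i)) → False := by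
      rintro e ⟨k, -, rfl⟩ ⟨k', -, h⟩
      have h1 := congrArg (fun e : Literature.MathematicalPhysics.QuantumLattice.ZdEdge d => e.1 j) h
      simp only [Pi.add_apply, Pi.single_eq_same, Pi.single_eq_of_ne hij.symm] at h1
      omega
    have hBD : ∀ e : Literature.MathematicalPhysics.QuantumLattice.ZdEdge d,
        (∃ k : ℕ, k < T ∧ e = (x + Pi.single i (R : ℤ) + Pi.single j (k : ℤ), j)) →
        (∃ k : ℕ, k < T ∧ e = (x + Pi.single j (k : ℤ), j)) → False := by
      rintro e ⟨k, -, rfl⟩ ⟨k', -, h⟩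
      have h1 := congrArg (fun e : Literature.MathematicalPhysics.QuantumLattice.ZdEdge d => e.1 i) h
      simp only [Pi.add_apply, Pi.single_eq_same, Pi.single_eq_of_ne hij] at h1
      omega
    rw [rectWalk, Walk.darts_append, Walk.darts_append, Walk.darts_append, List.map_append, List.map_append, List.map_append]
    rw [List.nodup_append]
    refine ⟨hnodup_line i R x, ?_, fun a ha b hb hab => ?_⟩
    · rw [List.nodup_append]
      refine ⟨by rw [Walk.darts_copy]; exact hnodup_line j T _, ?_, fun a ha b hb hab => ?_⟩
      · rw [List.nodup_append]
        refine ⟨by rw [hrev, List.nodup_reverse]; exact hnodup_line i R _,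
          by rw [hrev, List.nodup_reverse]; exact hnodup_line j T x, fun a ha b hb hab => ?_⟩
        obtain ⟨k, -, rfl⟩ := hC a ha
        obtain ⟨k', -, rfl⟩ := hD b hb
        exact hij (congrArg Prod.snd hab)
      · obtain ⟨k, hk, rfl⟩ := hB a ha
        rcases List.mem_append.1 hb with hb | hb
        · obtain ⟨k', -, rfl⟩ := hC b hb
          exact hij (congrArg Prod.snd hab).symm
        · exact hBD b ⟨k, hk, hab.symm⟩ (hD b hb)
    · obtain ⟨k, hk, rfl⟩ := hA a ha
      rcases List.mem_append.1 hb with hb | hb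
      · obtain ⟨k', -, rfl⟩ := hB b hb
        exact hij (congrArg Prod.snd hab)
      · rcases List.mem_append.1 hb with hb | hb
        · exact hAC b ⟨k, hk, hab.symm⟩ (hC b hb)
        · obtain ⟨k', -, rfl⟩ := hD b hb
          exact hij (congrArg Prod.snd hab)
  -- (c) every multiplicity is `1`, and the multiplicities add up to the perimeter
  have hm1 : ∀ e ∈ walkEdges (rectWalk x i j R T), dartMult (rectWalk x i j R T) e = 1 := by
    intro e he
    refine le_antisymm ?_ (one_le_dartMult_of_mem _ he)
    exact (@List.nodup_iff_count_le_one _ instBEqOfDecidableEq _ _).1 hnd e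
  calc ∑ e ∈ walkEdges (rectWalk x i j R T), (dartMult (rectWalk x i j R T) e : ℝ) ^ 2
      = ∑ e ∈ walkEdges (rectWalk x i j R T), (dartMult (rectWalk x i j R T) e : ℝ) := by
        refine Finset.sum_congr rfl fun e he => ?_
        rw [hm1 e he]; norm_num
    _ = ((rectWalk x i j R T).length : ℝ) := by rw [← sum_walkEdges_dartMult, Nat.cast_sum]
    _ = 2 * ((R : ℝ) + T) := by rw [length_rectWalk]; push_cast; ring

/-! ## §2. Rectangular Wilson loops: infinite-volume limit points, 't Hooft `|β| < 1/24` -/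

/-- ★★★ **Gaussian concentration of rectangular Wilson loops at the perimeter scale** under every infinite-volume limit point of `SU(2)`
lattice Yang–Mills on `ℤ³` at 't Hooft coupling `|β| < 1/24`: for every `R × T` rectangle (`R, T ≥ 1`, coordinate plane `(i, j)`, `i ≠ j`,
any base point) and every `r ≥ 0`, `μ{|W_{R×T} − ⟨W_{R×T}⟩_μ| ≥ r} ≤ 2 exp(−(1 − 24|β|) r²/(2(R+T)))`, `W = ½ Re tr hol`.  Strong coupling,
fixed lattice; the Yang–Mills mass gap is NOT proved. [cite: ShenZhuZhu2022, Theorem 1.4, Corollary 1.5] -/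
theorem szz_rectangle_twoSided_su2 {β : ℝ} (hβ : |β| < 1 / 24)
    {μ : Measure (LGConfig 3 (Matrix.specialUnitaryGroup (Fin 2) ℂ))}
    (hμ : μ ∈ infiniteVolumeLimitPoints (d := 3) (fundamentalRep (Fin 2)) (((2 : ℕ) : ℝ) * β))
    (x : Site 3) {i j : Fin 3} (hij : i ≠ j) {R T : ℕ} (hR : 1 ≤ R) (hT : 1 ≤ T) {r : ℝ} (hr : 0 ≤ r) :
    μ.real {U | r ≤ |wilsonLoopObs (fun g : Matrix.specialUnitaryGroup (Fin 2) ℂ => normalisedCharacter 2 (fundamentalRep (Fin 2) g))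
          (rectWalk x i j R T) U -
        loopExpectation μ (fun g : Matrix.specialUnitaryGroup (Fin 2) ℂ => normalisedCharacter 2 (fundamentalRep (Fin 2) g))
          (rectWalk x i j R T)|} ≤
      2 * Real.exp (-((1 - 24 * |β|) * r ^ 2 / (2 * ((R : ℝ) + T)))) := by
  have hw : 0 < (rectWalk x i j R T).length := by rw [length_rectWalk]; omega
  have h := szz_wilsonLoop_twoSided_su2 hβ hμ (rectWalk x i j R T) hw hr
  rw [sum_dartMult_sq_rectWalk x hij hR hT] at h
  exact h

/-- ★★ **Variance of rectangular Wilson loops grows at most with the perimeter**: under every infinite-volume limit point of `SU(2)` lattice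
Yang–Mills on `ℤ³` at 't Hooft coupling `|β| < 1/24`, `Var_μ(W_{R×T}) ≤ (R + T)/(1 − 24|β|)` for every `R × T` rectangle (`R, T ≥ 1`, `i ≠ j`)
(Shen–Zhu–Zhu Cor. 1.5 / Rem. 4.6 shape).  The Yang–Mills mass gap is NOT proved. [cite: ShenZhuZhu2022, Corollary 1.5, Remark 4.6] -/
theorem szz_rectangle_variance_su2 {β : ℝ} (hβ : |β| < 1 / 24)
    {μ : Measure (LGConfig 3 (Matrix.specialUnitaryGroup (Fin 2) ℂ))}
    (hμ : μ ∈ infiniteVolumeLimitPoints (d := 3) (fundamentalRep (Fin 2)) (((2 : ℕ) : ℝ) * β))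
    (x : Site 3) {i j : Fin 3} (hij : i ≠ j) {R T : ℕ} (hR : 1 ≤ R) (hT : 1 ≤ T) :
    Var[wilsonLoopObs (fun g : Matrix.specialUnitaryGroup (Fin 2) ℂ => normalisedCharacter 2 (fundamentalRep (Fin 2) g))
        (rectWalk x i j R T); μ] ≤ ((R : ℝ) + T) / (1 - 24 * |β|) := by
  have h := szz_wilsonLoop_variance_su2 hβ hμ (rectWalk x i j R T)
  rw [sum_dartMult_sq_rectWalk x hij hR hT] at h
  have hK : 0 < 1 - 24 * |β| := by linarith
  calc Var[wilsonLoopObs (fun g : Matrix.specialUnitaryGroup (Fin 2) ℂ => normalisedCharacter 2 (fundamentalRep (Fin 2) g))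
        (rectWalk x i j R T); μ] ≤ 2 * ((R : ℝ) + T) / (2 * (1 - 24 * |β|)) := h
    _ = ((R : ℝ) + T) / (1 - 24 * |β|) := by
        rw [mul_div_mul_left _ _ (two_ne_zero)]

/-! ## §3. Rectangular Wilson loops on every torus, tree coupling `|β'| < 1/12` -/

/-- ★★★ **Gaussian concentration of rectangular Wilson loops on every torus, uniformly in the volume.**  For the periodic `SU(2)` Wilson measure
on `(ℤ/L)³` at tree coupling `|β'| < 1/12`, every `R × T` rectangle (`R, T ≥ 1`, `i ≠ j`) whose links stay distinct on the torus (every fixed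
rectangle once `L` is large), read through the periodic lift, and every `r ≥ 0`:
`μ_{L,β'}{|W_{R×T} − ⟨W_{R×T}⟩| ≥ r} ≤ 2 exp(−(1 − 12|β'|) r²/(2(R+T)))` — the same bound in every volume.  Strong coupling, fixed lattice; the
Yang–Mills mass gap is NOT proved. [cite: ShenZhuZhu2022, Theorem 1.4, Corollary 1.5] -/
theorem torus_rectangle_twoSided_su2_uniform {β' : ℝ} (hβ : |β'| < 1 / 12) (L : ℕ) [NeZero L]
    (x : Site 3) {i j : Fin 3} (hij : i ≠ j) {R T : ℕ} (hR : 1 ≤ R) (hT : 1 ≤ T)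
    (hinj : Set.InjOn (torusEdge (d := 3) L) ↑(walkEdges (rectWalk x i j R T))) {r : ℝ} (hr : 0 ≤ r) :
    ((wilsonMeasure (d := 3) (L := L) (fundamentalRep (Fin 2)) β')).real {V | r ≤ |wilsonLoopObs (fun g : Matrix.specialUnitaryGroup (Fin 2) ℂ => normalisedCharacter 2 (fundamentalRep (Fin 2) g))
          (rectWalk x i j R T) (torusLift L V) -
        ∫ V', wilsonLoopObs (fun g : Matrix.specialUnitaryGroup (Fin 2) ℂ => normalisedCharacter 2 (fundamentalRep (Fin 2) g))
          (rectWalk x i j R T) (torusLift L V') ∂(wilsonMeasure (d := 3) (L := L) (fundamentalRep (Fin 2)) β')|} ≤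
      2 * Real.exp (-((1 - 12 * |β'|) * r ^ 2 / (2 * ((R : ℝ) + T)))) := by
  have hw : 0 < (rectWalk x i j R T).length := by rw [length_rectWalk]; omega
  have h := torus_wilsonLoop_twoSided_su2_uniform hβ L (rectWalk x i j R T) hinj hw hr
  rw [sum_dartMult_sq_rectWalk x hij hR hT] at h
  exact h

end Summit.QuantumFields.YangMills.Theorems.ColdStartUniversality

end
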